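import Summits.QuantumFields.BalabanUV.T4Continuum.Support.NE7ApeOfHalvingIteration
import Summits.QuantumFields.BalabanUV.T4Continuum.Support.NE3EnergyShapes
import Summits.QuantumFields.BalabanUV.T4Continuum.Support.AveragingDeficitTransport
import HarnessLib

/-!
# NE7ApeOfLocalChartLetter — [Balaban1985Variational] Sect. F's LAST TWO STEPS in kernel: the a-priori estimate with gain (`hape` of F31 ∕ F33 = [B11] Prop. 8
# p. 304) ⇐ a PER-PLAQUETTE LOCAL CHART LETTER ((152) + (167) TYPE, displayed: around every plaquette, in SOME unitary gauge, the configuration is `exp A` with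
# `|A|` small and the abelian curl `A(∂p)` bounded by «datum + θ·radius») — the plaquette is READ from the chart by the tree's linearisation `walk_linear`
# ((168) ∕ [B8] (1.54) TYPE, PROVED) and the affine improvement is ITERATED to the floor (p. 304, PROVED)

Cell `pub-balaban`, rung (B)+1 sub-cell t4, lineage `b2b-balaban-t4-ne7-p1` (CRUX PROVER NE7 #1 = OWNER of row NE7), generation 88; memo
`t4/b2b-balaban-t4-ne7-p1-g88/EXISTENCE-BY-INDUCTION.md` §0(A), §5.  File F243 (over F242 `NE7ApeOfHalvingIteration`, lit-balaban's `B7Prop1Explicit.walk_linear` ∕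
`hol_gaugeAct_closed` ∕ `norm_units_inv_conj_sub_one_le` ∕ `expRem4_le`, `AveragingDeficitTransport.mem_U1_of_unitary`).

WHY.  Gen 88's print read: F31's `hape` IS [B11] Prop. 8, proved in Sect. F (pp. 300–305) LOCALLY and with FLAT operators: around the plaquette, a local gauge and
the Landau chart `U″_k = e^{iηA}` with (167) `|A|, |∇A|, |∂*∂A|, |ΔA| < ¼M_Δ max{B₃ε₁, ½ε₀} + ¼M′ε₀`, then (168) «this and the inequality (1.54) of [6] imply
`|U₁(b) − 1| < ε′ + 86dε′² < 2ε′`» and the halving iteration.  THIS FILE types the INTERFACE between the analytic campaign ((SF1)–(SF5) of the memo: axial gauge,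
[B8] Thm 2 at `U₀ = 1` on nested cubes, B5∕B6 flat operators, the algebra) and the NE7 END: the campaign's OUTPUT is the per-plaquette letter `hloc` below —
NOTHING global, NO target radius, only «datum + contraction»; the plaquette reading and the iteration are proved here.
WHAT ([folklore]; 0 def, 0 sorry).
§1 `norm_plaq_sub_one_le_gaugeAct` — plaquette deviations are gauge invariant (unitary gauge): `‖U(∂p) − 1‖ ≤ ‖U^u(∂p) − 1‖`.
§2 `norm_plaq_sub_one_le_of_chart` — if `U^u = exp A` with `‖A‖ ≤ a ≤ 1∕64` on the bonds within `ℓ¹`-distance `4` of the corner, then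
   `‖U(∂p) − 1‖ ≤ ‖A(∂p)‖ + 16a²` (`A(∂p)` the abelian plaquette sum `asum A x (plaqWord κ κ′)`; `walk_linear` + `expRem4_le`).
§3 `smallField_orbit_of_affineImprovement`, `smallField_floor_of_affineImprovement` — the AFFINE iteration `r ↦ c + θr` (`0 ≤ θ < 1`, `c + θδ ≤ δ`): from radius `δ`
   to `θ^m δ + c(1 − θ^m)∕(1 − θ)` exactly, hence below any `δ₁ > c∕(1 − θ)`.
§4 **`hape_of_localChartLetter`** — `hloc` (per datum of `𝒟_β`, level, admissible tangent-critical `U` with `SmallField U (r∕M²)`, `0 ≤ r ≤ δ`, and plaquette: a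
   unitary gauge `u`, a chart `A` with `U^u = exp A`, `‖A‖ ≤ a ≤ 1∕64`, `16a² ≤ θ₂·r∕M²` near the corner, and `‖A(∂p)‖ ≤ (c₀ + θ₁r)∕M²`) with `θ₁ + θ₂ < 1`,
   `c₀ + (θ₁+θ₂)δ ≤ δ` ⟹ F31's `hape` for every `δ₁ > c₀∕(1 − θ₁ − θ₂)`.
HONEST FRAMING (page 1): `hloc` ([B11] (152)∕(167) TYPE) is a HYPOTHESIS asserted for nothing — it is exactly what Sect. F's local flat machinery proves in print and
what the tree does NOT yet have ((SF3) [B8] Thm 2 on nested cubes, (SF4) B5∕B6 multi-domain operators); nothing of Bałaban's asserted; NOT (APE), NOT ONE-STEP,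
NOT NE7; spine 0∕9; finite T⁴ rung (B)+1 — NOT infinite volume, NOT mass gap, NOT `BetaPertH`, NOT Clay.  Continuum YM on T⁴ ⇐ BetaPertH ∧ nine spine estimates
(0/9 proved); BetaPertH ⇐ (D1) ∧ (D4) ∧ CAP+tail; G-an2-4 gates asym, D1 and NE2/3/4.
-/

set_option autoImplicit false

open scoped BigOperators Matrix Matrix.Norms.L2Operator
open NormedSpace Finset

namespace Summit.QuantumFields.BalabanUV.T4Continuum.NE7ApeOfLocalChartLetter

open Literature.MathematicalPhysics.QuantumFieldTheory.Balaban1983to89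
open B7Prop1Explicit B7Prop2Explicit
open T4AveragingDeficitWall (IsUnitaryCfg IsSkewDir SmallField)
open T4AveragingDeficitWallBoundary (IsPeriodicCfg)
open AveragingDeficitPeriodicCounting (IsPeriodicDir)
open AveragingDeficitMultiLevelPrep (TangentIter)
open MinimalActionLevels (perWin)
open MinimalActionSandwich (admissible)
open MinimalActionRate (sfClass)
open NE3HessForm (dAction)
open NE3EnergyShapes (IsUnitarySite)
open AveragingDeficitTransport (mem_U1_of_unitary)

noncomputable section

variable {d : ℕ} {n : Type*} [Fintype n] [DecidableEq n]

/-! ## §1 Plaquette deviations are gauge invariant -/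

/-- **The plaquette deviation of `U` is at most that of any unitary gauge transform `U^u`** (in fact equal): `U(∂p) = u(x)⁻¹·U^u(∂p)·u(x)`. [folklore] -/
theorem norm_plaq_sub_one_le_gaugeAct [Nonempty n] {U : Site d → Fin d → (Matrix n n ℂ)ˣ} {u : Site d → (Matrix n n ℂ)ˣ} (hu : IsUnitarySite u)
    (x : Site d) (κ κ' : Fin d) :
    ‖((hol U x (plaqWord κ κ') : (Matrix n n ℂ)ˣ) : Matrix n n ℂ) - 1‖
      ≤ ‖((hol (gaugeAct u U) x (plaqWord κ κ') : (Matrix n n ℂ)ˣ) : Matrix n n ℂ) - 1‖ := by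
  have hid : hol U x (plaqWord κ κ') = (u x)⁻¹ * hol (gaugeAct u U) x (plaqWord κ κ') * u x := by
    rw [hol_gaugeAct_closed u U x _ (disp_plaqWord κ κ')]; group
  rw [hid, Units.val_mul, Units.val_mul]
  exact norm_units_inv_conj_sub_one_le (mem_U1_of_unitary (hu x)) _

/-! ## §2 Reading the plaquette from a local chart ((168) ∕ [B8] (1.54) TYPE, via `walk_linear`) -/

/-- **THE PLAQUETTE FROM THE CHART**: if in a unitary gauge `u` the configuration is `exp A` with `‖A‖ ≤ a ≤ 1∕64` on every bond within `ℓ¹`-distance `4` of `x`,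
then `‖U(∂p_{κκ′}(x)) − 1‖ ≤ ‖A(∂p)‖ + 16a²`, `A(∂p) = asum A x (plaqWord κ κ′) = A(x,κ) + A(x+e_κ,κ′) − A(x+e_κ′,κ) − A(x,κ′)`. [folklore] -/
theorem norm_plaq_sub_one_le_of_chart [Nonempty n] {U : Site d → Fin d → (Matrix n n ℂ)ˣ} {u : Site d → (Matrix n n ℂ)ˣ} (hu : IsUnitarySite u)
    {A : Site d → Fin d → Matrix n n ℂ} {a : ℝ} (ha0 : 0 ≤ a) (ha : a ≤ 1 / 64) (x : Site d)
    (hchart : ∀ (y : Site d) (μ : Fin d), l1 (y - x) ≤ 4 → ((gaugeAct u U y μ : (Matrix n n ℂ)ˣ) : Matrix n n ℂ) = exp (A y μ) ∧ ‖A y μ‖ ≤ a)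
    (κ κ' : Fin d) :
    ‖((hol U x (plaqWord κ κ') : (Matrix n n ℂ)ˣ) : Matrix n n ℂ) - 1‖ ≤ ‖asum A x (plaqWord κ κ')‖ + 16 * a ^ 2 := by
  have hlen : (plaqWord κ κ' : List (Letter d)).length = 4 := rfl
  obtain ⟨-, h2⟩ := walk_linear (gaugeAct u U) A x 4 ha0 hchart (plaqWord κ κ') x (by simp [l1, hlen])
  rw [hlen] at h2
  have hrem : expRem ((4 : ℕ) * a) ≤ 16 * a ^ 2 := by exact_mod_cast expRem4_le ha0 ha
  calc ‖((hol U x (plaqWord κ κ') : (Matrix n n ℂ)ˣ) : Matrix n n ℂ) - 1‖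
      ≤ ‖((hol (gaugeAct u U) x (plaqWord κ κ') : (Matrix n n ℂ)ˣ) : Matrix n n ℂ) - 1‖ := norm_plaq_sub_one_le_gaugeAct hu x κ κ'
    _ = ‖(((hol (gaugeAct u U) x (plaqWord κ κ') : (Matrix n n ℂ)ˣ) : Matrix n n ℂ) - 1 - asum A x (plaqWord κ κ'))
          + asum A x (plaqWord κ κ')‖ := by rw [sub_add_cancel]
    _ ≤ ‖((hol (gaugeAct u U) x (plaqWord κ κ') : (Matrix n n ℂ)ˣ) : Matrix n n ℂ) - 1 - asum A x (plaqWord κ κ')‖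
          + ‖asum A x (plaqWord κ κ')‖ := norm_add_le _ _
    _ ≤ 16 * a ^ 2 + ‖asum A x (plaqWord κ κ')‖ := by gcongr; exact h2.trans hrem
    _ = _ := add_comm _ _

/-! ## §3 The affine iteration `r ↦ c + θ·r` down to the floor `c∕(1 − θ)` -/

/-- **THE ORBIT OF THE AFFINE IMPROVEMENT** (one configuration, scale `S > 0`): if radius `r∕S` improves to `(c + θr)∕S` for every `r ∈ [0, δ]` (`0 ≤ c`,
`0 ≤ θ < 1`, `c + θδ ≤ δ`), then from `SmallField U (δ∕S)`: `SmallField U ((θ^m δ + c(1 − θ^m)∕(1 − θ))∕S)` for every `m` (the exact orbit). [folklore] -/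
theorem smallField_orbit_of_affineImprovement {U : Site d → Fin d → (Matrix n n ℂ)ˣ} {S c θ δ : ℝ} (hc : 0 ≤ c) (hθ0 : 0 ≤ θ) (hθ1 : θ < 1)
    (hcδ : c + θ * δ ≤ δ)
    (himp : ∀ r : ℝ, 0 ≤ r → r ≤ δ → SmallField U (r / S) → SmallField U ((c + θ * r) / S)) (hU : SmallField U (δ / S)) :
    ∀ m : ℕ, SmallField U ((θ ^ m * δ + c * (1 - θ ^ m) / (1 - θ)) / S) := by
  have h1θ : 0 < 1 - θ := by linarith
  have hδc : c / (1 - θ) ≤ δ := by rw [div_le_iff₀ h1θ]; linarith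
  have hδ0 : 0 ≤ δ := le_trans (div_nonneg hc h1θ.le) hδc
  intro m
  induction m with
  | zero => simpa using hU
  | succ m ih =>
    have hθm0 : 0 ≤ θ ^ m := pow_nonneg hθ0 m
    have hθm1 : θ ^ m ≤ 1 := pow_le_one₀ hθ0 hθ1.le
    set r : ℝ := θ ^ m * δ + c * (1 - θ ^ m) / (1 - θ) with hr
    have hr0 : 0 ≤ r := by
      have : 0 ≤ c * (1 - θ ^ m) / (1 - θ) := div_nonneg (mul_nonneg hc (by linarith)) h1θ.le
      rw [hr]; positivity
    have hrδ : r ≤ δ := by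
      -- `r = θ^m δ + (1 − θ^m)·(c∕(1−θ)) ≤ θ^m δ + (1 − θ^m) δ = δ`
      have : c * (1 - θ ^ m) / (1 - θ) = (1 - θ ^ m) * (c / (1 - θ)) := by ring
      rw [hr, this]
      nlinarith
    have hstep := himp r hr0 hrδ ih
    have heq : c + θ * r = θ ^ (m + 1) * δ + c * (1 - θ ^ (m + 1)) / (1 - θ) := by
      rw [hr, pow_succ]; field_simp; ring
    rwa [heq] at hstep

/-- **DOWN TO THE FLOOR**: under the hypotheses of `smallField_orbit_of_affineImprovement`, every `δ₁ > c∕(1 − θ)` is reached: `SmallField U (δ₁∕S)` («we continue this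
way until we reach the bound B₃ε₁», p. 304). [cite: Balaban1985Variational, Prop. 8 p.304] -/
theorem smallField_floor_of_affineImprovement {U : Site d → Fin d → (Matrix n n ℂ)ˣ} {S c θ δ δ₁ : ℝ} (hS : 0 < S) (hc : 0 ≤ c) (hθ0 : 0 ≤ θ) (hθ1 : θ < 1)
    (hcδ : c + θ * δ ≤ δ) (hδ₁ : c / (1 - θ) < δ₁)
    (himp : ∀ r : ℝ, 0 ≤ r → r ≤ δ → SmallField U (r / S) → SmallField U ((c + θ * r) / S)) (hU : SmallField U (δ / S)) :
    SmallField U (δ₁ / S) := by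
  have h1θ : 0 < 1 - θ := by linarith
  have hδc : c / (1 - θ) ≤ δ := by rw [div_le_iff₀ h1θ]; linarith
  have hgap : 0 < δ₁ - c / (1 - θ) := by linarith
  rcases le_or_gt δ 0 with hδ | hδ
  · -- `δ ≤ 0`: then `c = 0`, the radius is already `≤ 0 ≤ δ₁`
    refine MinimalActionRate.SmallField.mono hU (div_le_div_of_nonneg_right ?_ hS.le)
    have : 0 ≤ c / (1 - θ) := div_nonneg hc h1θ.le
    linarith
  · obtain ⟨m, hm⟩ := exists_pow_lt_of_lt_one (div_pos hgap hδ) hθ1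
    have hm' : θ ^ m * δ < δ₁ - c / (1 - θ) := (lt_div_iff₀ hδ).mp hm
    refine MinimalActionRate.SmallField.mono (smallField_orbit_of_affineImprovement hc hθ0 hθ1 hcδ himp hU m)
      (div_le_div_of_nonneg_right ?_ hS.le)
    have hθm0 : 0 ≤ θ ^ m := pow_nonneg hθ0 m
    have : c * (1 - θ ^ m) / (1 - θ) ≤ c / (1 - θ) := by
      rw [div_le_div_iff_of_pos_right h1θ]; nlinarith
    linarith

/-! ## §4 THE END: `hape` of F31 ∕ F33 from the per-plaquette local chart letter -/

/-- **`hape` ⇐ THE PER-PLAQUETTE LOCAL CHART LETTER** ([B11] Sect. F (152) + (167) TYPE ⟹ (168) ⟹ Prop. 8, here: `hloc` displayed, the rest proved).  `hloc`: for every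
datum `D ∈ 𝒟_β`, level `k+1`, `U ∈ admissible (sfClass d L N ε) L (k+1) D` tangent-critical with `SmallField U (r∕M²)`, `0 ≤ r ≤ δ`, and every plaquette corner `x` and
plane `κ ≠ κ′`: a unitary gauge `u`, a chart `A` and a size `a` with `U^u = exp A`, `‖A‖ ≤ a` on the bonds within `ℓ¹`-distance `4` of `x`, `0 ≤ a ≤ 1∕64`, `16a² ≤
θ₂·r∕M²`, and the CURL LETTER `‖A(∂p_{κκ′}(x))‖ ≤ (c₀ + θ₁·r)∕M²`.  With `c₀ ≥ 0`, `θ₁, θ₂ ≥ 0`, `θ₁ + θ₂ < 1`, `c₀ + (θ₁ + θ₂)δ ≤ δ`: F31's `hape` holds for every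
`δ₁ > c₀∕(1 − θ₁ − θ₂)`. [cite: Balaban1985Variational, Prop. 8 p.304] -/
theorem hape_of_localChartLetter [Nonempty n] {L N : ℕ} (hL : 1 ≤ L) {ε δ δ₁ β c₀ θ₁ θ₂ : ℝ} (hc₀ : 0 ≤ c₀) (hθ₁ : 0 ≤ θ₁) (hθ₂ : 0 ≤ θ₂)
    (hθ : θ₁ + θ₂ < 1) (hcδ : c₀ + (θ₁ + θ₂) * δ ≤ δ) (hδ₁ : c₀ / (1 - (θ₁ + θ₂)) < δ₁)
    (hloc : ∀ D : Site d → Fin d → (Matrix n n ℂ)ˣ, IsUnitaryCfg D → IsPeriodicCfg D (N : ℤ) → SmallField D (4 * (Real.exp β - 1)) →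
      ∀ (k : ℕ), ∀ U ∈ admissible (sfClass d L N ε) L (k + 1) D,
      (∀ φ : Site d → Fin d → Matrix n n ℂ, IsSkewDir φ → IsPeriodicDir φ ((N * L ^ (k + 1) : ℕ) : ℤ) → TangentIter L k U φ →
        dAction U φ (perWin d (N * L ^ (k + 1))) = 0) →
      ∀ r : ℝ, 0 ≤ r → r ≤ δ → SmallField U (r / ((L : ℝ) ^ (k + 1)) ^ 2) →
      ∀ (x : Site d) (κ κ' : Fin d), κ ≠ κ' →
        ∃ (u : Site d → (Matrix n n ℂ)ˣ) (A : Site d → Fin d → Matrix n n ℂ) (a : ℝ), IsUnitarySite u ∧ 0 ≤ a ∧ a ≤ 1 / 64 ∧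
          16 * a ^ 2 ≤ θ₂ * r / ((L : ℝ) ^ (k + 1)) ^ 2 ∧
          (∀ (y : Site d) (μ : Fin d), l1 (y - x) ≤ 4 → ((gaugeAct u U y μ : (Matrix n n ℂ)ˣ) : Matrix n n ℂ) = exp (A y μ) ∧ ‖A y μ‖ ≤ a) ∧
          ‖asum A x (plaqWord κ κ')‖ ≤ (c₀ + θ₁ * r) / ((L : ℝ) ^ (k + 1)) ^ 2) :
    ∀ D : Site d → Fin d → (Matrix n n ℂ)ˣ, IsUnitaryCfg D → IsPeriodicCfg D (N : ℤ) → SmallField D (4 * (Real.exp β - 1)) →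
      ∀ (k : ℕ), ∀ U ∈ admissible (sfClass d L N ε) L (k + 1) D, SmallField U (δ / ((L : ℝ) ^ (k + 1)) ^ 2) →
      (∀ φ : Site d → Fin d → Matrix n n ℂ, IsSkewDir φ → IsPeriodicDir φ ((N * L ^ (k + 1) : ℕ) : ℤ) → TangentIter L k U φ →
        dAction U φ (perWin d (N * L ^ (k + 1))) = 0) → SmallField U (δ₁ / ((L : ℝ) ^ (k + 1)) ^ 2) := by
  intro D hDu hDP hDs k U hU hUδ hcrit
  have hLpos : (0 : ℝ) < L := by exact_mod_cast (by omega : 0 < L)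
  set S : ℝ := ((L : ℝ) ^ (k + 1)) ^ 2 with hSdef
  have hS : 0 < S := by positivity
  -- the affine improvement at this configuration, plaquette by plaquette
  have himp : ∀ r : ℝ, 0 ≤ r → r ≤ δ → SmallField U (r / S) → SmallField U ((c₀ + (θ₁ + θ₂) * r) / S) := by
    intro r hr0 hrδ hUr x κ κ' hκκ'
    obtain ⟨u, A, a, hu, ha0, ha, ha2, hchart, hcurl⟩ := hloc D hDu hDP hDs k U hU hcrit r hr0 hrδ hUr x κ κ' hκκ'
    calc ‖((hol U x (plaqWord κ κ') : (Matrix n n ℂ)ˣ) : Matrix n n ℂ) - 1‖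
        ≤ ‖asum A x (plaqWord κ κ')‖ + 16 * a ^ 2 := norm_plaq_sub_one_le_of_chart hu ha0 ha x hchart κ κ'
      _ ≤ (c₀ + θ₁ * r) / S + θ₂ * r / S := add_le_add hcurl ha2
      _ = (c₀ + (θ₁ + θ₂) * r) / S := by rw [hSdef]; ring
  exact smallField_floor_of_affineImprovement hS hc₀ (by positivity) hθ hcδ hδ₁ himp hUδ

end

end Summit.QuantumFields.BalabanUV.T4Continuum.NE7ApeOfLocalChartLetter
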